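import Literature.NumberTheory.EllipticCurves.HeegnerPointsKolyvaginPrimaryCebotarevKernelProofs
import Summits.BirchSwinnertonDyer.BirchSwinnertonDyer.Theorems.PrintCFramBottomClassIndexLawFiveLeBorelGrossSurjectivityTowerLeaf
import HarnessLib

/-!
# Route `PrintCFram`, crux C2 `BottomClassIndexLawFiveLe` (stmt-BirchSwinnertonDyer-20372), line
# `eisenstein-resource-bdp-line` (stub `stub_kolyvaginUpper_borelCM_pairSum_offKrizLi`, last link
# of the S2 machine map): **McCallum 1991, Prop. 3.1 in KERNEL FORM from an INTERTWINING Galois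
# element** — the Čebotarev step with McCallum's character `φ = [·, ρ]` as a HYPOTHESIS, image-free,
# and its instance at the Borel CM-ramified prime
# (cell `bsd-print-cfram`, seat `bsd-line-cfram-p1-w2` g6; helper `--supports` 20372; 0 facts, 0 defs)

HONEST FRAMING. Nothing about BSD is proved here, and nothing of the stub itself. The tree's
`exists_kolyvaginPrime_gt_pow_kernel` (McCallum's Prop. 3.1 in kernel form) destructures the
surjective image `hρ : W.HasSurjectiveModNGaloisRep p` in its Step A (producing `−1 ∈ ρ̄(Γ_K)`,
`E[p]` simple, scalar commutant) and uses those ONLY to manufacture, in Step B, McCallum's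
character `φ : ⟨g₁, g₂, T⟩ → E[p^M]` and a Galois element `ρ ∈ Γ_{K(E[p^M])}` realising it
(`[x_i, ρ] = φ(x_i)`), after which Steps C–H are the image-free Čebotarev theorem
`exists_kolyvaginPrime_gt_of_galoisElement`. This file isolates the one algebraic identity that
links the two halves — for `ρ ∈ Γ_{K(E[n])}` INTERTWINING `σ_*` and `τ` on a `σ_*`-stable subgroup
`G` of classes (`[σ_* x, ρ] = τ [x, ρ]` for `x ∈ G`), every `m` killing `G` gives
**`[x, (ρm)^τ (ρm)] = 2 [x, ρ]`** (`h1Eval_conjGalCMH_mul_mul_eq_two_zsmul`) — and concludes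
McCallum's (3) in kernel form with `(G, ρ)` as HYPOTHESES:
`exists_kolyvaginPrime_gt_pow_kernel_of_intertwining` (kernel of `loc_λ` on `G` = kernel of
`[·, ρ]` on `G`), with the eigen-form corollary `…_of_eigenTargets` (generators `σ_*`-eigen,
values `τ`-eigen of the same signs — McCallum's `φ(G^±) ⊆ ℤ e_±`). The surjective-image theorem of
the tree is the case where Step A/B supply `ρ`; at the Borel CM-ramified prime, where Step A's
three inputs FAIL (w2 g5 / w4 g2–g3 files), `ρ` is supplied by the uniserial / `𝔭`-adic McCallum (2)
of the class (`exists_h1Eval_eq_pow_of_cmRamified`, p645154): `exists_kolyvaginPrime_gt_pow_kernel_of_cmRamified`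
— for `σ_*`-eigenclasses with `𝓞`-depths `e_i` and independent top-layer functionals, and ANY
`τ`-eigen targets `t_i ∈ W[𝔭^{e_i}]` of the same signs, a Kolyvagin prime `ℓ > b` of level `p^M`
with `x_λ = 0 ⟺ [x, ρ] = 0` on the span, `[x_i, ρ] = t_i`. Which targets are AVAILABLE (the
`τ`-eigenspaces of the layers `W[𝔭^e]`) is the visibility question of the sibling file
`…BorelKolyvaginVisibility`. THEOREMS ONLY; no definition, no named fact, no `sorry`; inputs: the
Čebotarev density theorem (`Automorphic.chebotarev_artinRep`, as in the tree). BSD is not proved by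
any of this; no summit statement is proved by this seat.
References: [McCallumLMS1991] §3 Prop. 3.1 with (2), (3) (PDF pp. 279–280); [GrossLMS1991] §9.
-/

set_option autoImplicit false
-- `…BirchSwinnertonDyer.BirchSwinnertonDyer.Theorems…` is the problem's mandated namespace (D-0017).
set_option linter.dupNamespace false

noncomputable section

open scoped Classical

namespace Summit.BirchSwinnertonDyer.BirchSwinnertonDyer.Theorems.PrintCFram.BorelKolyvaginPairing

open WeierstrassCurve NumberField IsDedekindDomain Field Literature.NumberTheory.EllipticCurves
  Literature.NumberTheory.GaloisRepresentations Literature.NumberTheory.EllipticCurves.Rank1Residual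

universe u v

/-! ## §1 The intertwining identity `[x, (ρm)^τ(ρm)] = 2[x, ρ]` (any field, any curve, any `n`) -/

section Algebra

variable {k : Type v} {K : Type u} [Field k] [Field K] [Algebra k K] (W : WeierstrassCurve k)
variable {σ : K ≃ₐ[k] K} {τ : AlgebraicClosure K ≃+* AlgebraicClosure K}

/-- `[x, ρ^τ] = τ [σ_* x, ρ]` for an involutive lift `τ` of `σ` and `ρ ∈ Γ_{K(E[n])}` (the tree's
`h1Eval_conjAct` read backwards through `τ² = 1`). [folklore] -/
theorem h1Eval_conjGalCMH_eq_torsionMap (hτ : IsLiftOfAut σ τ) (hinv : ∀ x, τ (τ x) = x) (n : ℤ)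
    (x : galH1Torsion (W.baseChange K) n) {ρ : absoluteGaloisGroup K}
    (hρ : ρ ∈ torsionFixing (W.baseChange K) n) :
    h1Eval (W.baseChange K) n x (hτ.conjGalCMH ρ) =
      hτ.torsionMap W n (h1Eval (W.baseChange K) n (conjAct W σ n x) ρ) := by
  rw [hτ.h1Eval_conjAct W n x hρ, hτ.torsionMap_torsionMap W hinv]

/-- **`[x, ρ^τ ρ] = τ [σ_* x, ρ] + [x, ρ]`** for `ρ ∈ Γ_{K(E[n])}` — McCallum's computation of
`φ_{Frob(λ)}`, `Frob(λ) = (τρ)² = ρ^τ ρ`, before any eigen-assumption. [cite: McCallumLMS1991, §3 proof of Prop. 3.1] -/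
theorem h1Eval_conjGalCMH_mul_eq (hτ : IsLiftOfAut σ τ) (hinv : ∀ x, τ (τ x) = x) (n : ℤ)
    (x : galH1Torsion (W.baseChange K) n) {ρ : absoluteGaloisGroup K}
    (hρ : ρ ∈ torsionFixing (W.baseChange K) n) :
    h1Eval (W.baseChange K) n x (hτ.conjGalCMH ρ * ρ) =
      hτ.torsionMap W n (h1Eval (W.baseChange K) n (conjAct W σ n x) ρ) +
        h1Eval (W.baseChange K) n x ρ := by
  rw [h1Eval_mul _ _ _ (hτ.conjGalCMH_mem_torsionFixing W hinv _ hρ),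
    h1Eval_conjGalCMH_eq_torsionMap W hτ hinv n x hρ]

/-- **The intertwining identity.** Let `G` be a `σ_*`-stable subgroup of `H¹(K, E[n])`,
`ρ ∈ Γ_{K(E[n])}` an element INTERTWINING `σ_*` and `τ` on `G` (`[σ_* x, ρ] = τ [x, ρ]` for
`x ∈ G`), and `m ∈ Γ_{K(E[n])}` killing `G` (`[x, m] = 0`). Then for every `x ∈ G`,
**`[x, (ρm)^τ (ρm)] = 2 [x, ρ]`** — McCallum's `φ_{Frob(λ)} = 2φ` with `φ = [·, ρ]|_G`, no image
hypothesis, no eigen-decomposition. [cite: McCallumLMS1991, §3 Prop. 3.1 (proof, (2)–(3))] -/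
theorem h1Eval_conjGalCMH_mul_mul_eq_two_zsmul (hτ : IsLiftOfAut σ τ) (hinv : ∀ x, τ (τ x) = x)
    (n : ℤ) {G : AddSubgroup (galH1Torsion (W.baseChange K) n)}
    (hG : ∀ x ∈ G, conjAct W σ n x ∈ G) {ρ : absoluteGaloisGroup K}
    (hρ : ρ ∈ torsionFixing (W.baseChange K) n)
    (hστ : ∀ x ∈ G, h1Eval (W.baseChange K) n (conjAct W σ n x) ρ =
      hτ.torsionMap W n (h1Eval (W.baseChange K) n x ρ))
    {m : absoluteGaloisGroup K} (hm : m ∈ torsionFixing (W.baseChange K) n)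
    (hmG : ∀ x ∈ G, h1Eval (W.baseChange K) n x m = 0)
    {x : galH1Torsion (W.baseChange K) n} (hx : x ∈ G) :
    h1Eval (W.baseChange K) n x (hτ.conjGalCMH (ρ * m) * (ρ * m)) =
      (2 : ℤ) • h1Eval (W.baseChange K) n x ρ := by
  have hρm : ρ * m ∈ torsionFixing (W.baseChange K) n := mul_mem hρ hm
  rw [h1Eval_conjGalCMH_mul_eq W hτ hinv n x hρm, h1Eval_mul _ _ _ hρ, h1Eval_mul _ _ _ hρ,
    hmG x hx, hmG _ (hG x hx), add_zero, add_zero, hστ x hx, hτ.torsionMap_torsionMap W hinv,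
    two_zsmul]

/-- **Eigen-generators give a `σ_*`-stable span.** If every generator `x_i` is a `σ_*`-eigenclass
with an integer eigenvalue, the subgroup they generate is `σ_*`-stable. [folklore] -/
theorem conjAct_mem_closure_of_eigen (n : ℤ) {ι : Type*}
    {xs : ι → galH1Torsion (W.baseChange K) n} {ν : ι → ℤ}
    (hxs : ∀ i, conjAct W σ n (xs i) = ν i • xs i)
    {x : galH1Torsion (W.baseChange K) n} (hx : x ∈ AddSubgroup.closure (Set.range xs)) :
    conjAct W σ n x ∈ AddSubgroup.closure (Set.range xs) := by
  induction hx using AddSubgroup.closure_induction with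
  | mem y hy =>
    obtain ⟨i, rfl⟩ := hy
    rw [hxs i]
    exact AddSubgroup.zsmul_mem _ (AddSubgroup.subset_closure (Set.mem_range_self i)) _
  | zero => rw [map_zero]; exact zero_mem _
  | add a b _ _ ha hb => rw [map_add]; exact add_mem ha hb
  | neg a _ ha => rw [map_neg]; exact neg_mem ha

/-- **Eigen-generators with eigen-values of the same signs give an intertwining element.** If
`σ_* x_i = ν_i x_i` and `τ [x_i, ρ] = ν_i [x_i, ρ]` with `ν_i = ±1` (McCallum's
`φ(G^±) ⊆ ℤ e_±`), then `ρ` intertwines `σ_*` and `τ` on the span of the `x_i`. [cite: McCallumLMS1991, §3 Prop. 3.1 (proof)] -/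
theorem h1Eval_conjAct_eq_torsionMap_of_eigen (hτ : IsLiftOfAut σ τ) (n : ℤ) {ι : Type*}
    {xs : ι → galH1Torsion (W.baseChange K) n} {ν : ι → ℤ}
    (hxs : ∀ i, conjAct W σ n (xs i) = ν i • xs i) {ρ : absoluteGaloisGroup K}
    (hρ : ρ ∈ torsionFixing (W.baseChange K) n)
    (hvals : ∀ i, hτ.torsionMap W n (h1Eval (W.baseChange K) n (xs i) ρ) =
      ν i • h1Eval (W.baseChange K) n (xs i) ρ)
    {x : galH1Torsion (W.baseChange K) n} (hx : x ∈ AddSubgroup.closure (Set.range xs)) :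
    h1Eval (W.baseChange K) n (conjAct W σ n x) ρ =
      hτ.torsionMap W n (h1Eval (W.baseChange K) n x ρ) := by
  induction hx using AddSubgroup.closure_induction with
  | mem y hy =>
    obtain ⟨i, rfl⟩ := hy
    rw [hxs i, h1Eval_zsmul _ _ _ _ hρ, hvals i]
  | zero => rw [map_zero, h1Eval_zero _ _ hρ, map_zero]
  | add a b _ _ ha hb => rw [map_add, h1Eval_add _ _ _ _ hρ, h1Eval_add _ _ _ _ hρ, map_add, ha, hb]
  | neg a _ ha => rw [map_neg, h1Eval_neg _ _ _ hρ, h1Eval_neg _ _ _ hρ, map_neg, ha]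

/-- `2` is injective on `E[n]` when some `u` has `(2u) P = P` (`n` odd). [folklore] -/
theorem two_zsmul_eq_zero_iff {n : ℤ} {u : ℤ}
    (hu : ∀ P : geomTorsion (W.baseChange K) n, (2 * u) • P = P)
    (P : geomTorsion (W.baseChange K) n) : (2 : ℤ) • P = 0 ↔ P = 0 := by
  refine ⟨fun h ↦ ?_, fun h ↦ by rw [h, zsmul_zero]⟩
  rw [← hu P, mul_comm, mul_zsmul, h, zsmul_zero]

end Algebra

/-! ## §2 McCallum's Prop. 3.1 in kernel form from an intertwining element (any `E/ℚ`, `K` imaginary quadratic) -/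

section Kernel

variable {W : WeierstrassCurve ℚ} {K : Type u} [Field K] [NumberField K]

/-- **McCallum 1991, Prop. 3.1 (kernel form) from an INTERTWINING Galois element — image-free.**
`K` imaginary quadratic with complex conjugation `c`, lifted to `K̄` along a complex conjugation
`c₀ ∈ Γ_ℚ` (`τ = e c₀ e⁻¹`, involutive); `p` an odd prime, level `n = p^M`; finitely many classes
`x_i ∈ H¹(K, E[p^M])` whose span `G` is `c_*`-stable; `ρ ∈ Γ_{K(E[p^M])}` intertwining `c_*` and
`τ` on `G`. Then above every bound `b` there is a prime `ℓ` with `ℓ ∤ N`, `ℓ ∤ d_K`, `ℓ ≠ p`,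
`(ℓ)` prime in `𝓞 K`, `Frob(ℓ) = Frob(∞)` in `Gal(K(E_{p^M})/ℚ)`, and at the place `λ ∋ ℓ`:
**`x_λ = 0 ⟺ [x, ρ] = 0` for every `x ∈ G`** — McCallum's (3) *"`c_λ = 0` iff
`φ_{Frob(λ)}(c) = 0`"* for the character `φ = [·, ρ]|_G`. The tree's
`exists_kolyvaginPrime_gt_pow_kernel` is the case where `ρ` is manufactured from a surjective
image; here `ρ` is a hypothesis, so any realiser (e.g. the Borel CM one of §3) can be plugged in.
[cite: McCallumLMS1991, §3 Prop. 3.1 with (2), (3)] -/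
theorem exists_kolyvaginPrime_gt_pow_kernel_of_intertwining (hC : Literature.NumberTheory.Automorphic.chebotarev_artinRep)
    {N : ℕ} [NeZero N] [W.IsElliptic] (hK : IsImaginaryQuadratic K) {p : ℕ} (hp : p.Prime)
    (hp2 : p ≠ 2) {M : ℕ} {c : K ≃ₐ[ℚ] K} {c₀ : absoluteGaloisGroup ℚ}
    (hc₀ : IsComplexConjugation (Rat.castHom ℝ) c₀)
    (ht : IsLiftOfAut c (absGaloisTransport (K := ℚ) (L := K) c₀).toRingEquiv)
    (hinv : ∀ x, (absGaloisTransport (K := ℚ) (L := K) c₀).toRingEquiv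
      ((absGaloisTransport (K := ℚ) (L := K) c₀).toRingEquiv x) = x)
    {ι : Type*} [Fintype ι] (cs : ι → galH1Torsion (W.baseChange K) ((p ^ M : ℕ) : ℤ))
    (hG : ∀ x ∈ AddSubgroup.closure (Set.range cs),
      conjAct W c ((p ^ M : ℕ) : ℤ) x ∈ AddSubgroup.closure (Set.range cs))
    {ρ : absoluteGaloisGroup K} (hρT : ρ ∈ torsionFixing (W.baseChange K) ((p ^ M : ℕ) : ℤ))
    (hστ : ∀ x ∈ AddSubgroup.closure (Set.range cs),
      h1Eval (W.baseChange K) ((p ^ M : ℕ) : ℤ) (conjAct W c ((p ^ M : ℕ) : ℤ) x) ρ =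
        ht.torsionMap W ((p ^ M : ℕ) : ℤ) (h1Eval (W.baseChange K) ((p ^ M : ℕ) : ℤ) x ρ))
    (b : ℕ) :
    ∃ ℓ : ℕ, b < ℓ ∧ ℓ.Prime ∧ ¬ ℓ ∣ N ∧ ¬ ((ℓ : ℤ) ∣ NumberField.discr K) ∧ ℓ ≠ p ∧
      (Ideal.span {(ℓ : 𝓞 K)}).IsPrime ∧ FrobEqFrobInfty W K (p ^ M) ℓ ∧
      ∀ x ∈ AddSubgroup.closure (Set.range cs),
        ∀ v : HeightOneSpectrum (𝓞 K), (ℓ : 𝓞 K) ∈ v.asIdeal →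
          (x ∈ (W.baseChange K).torsionLocalKer (v.adicCompletion K) ((p ^ M : ℕ) : ℤ) ↔
            h1Eval (W.baseChange K) ((p ^ M : ℕ) : ℤ) x ρ = 0) := by
  have hodd : Odd p := hp.odd_of_ne_two hp2
  obtain ⟨u, hu⟩ := exists_two_mul_zsmul_eq_of_odd (W.baseChange K) (n := p ^ M) hodd.pow
  -- Steps C–H of the tree: the Čebotarev prime with Frobenius `(ρm)^τ(ρm)` over `K`, `m ∈ 𝒩`
  obtain ⟨ℓ, hbℓ, hℓ, hℓN, hℓD, hℓp, hprime, hfrob, m, hm, hloc⟩ :=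
    exists_kolyvaginPrime_gt_of_galoisElement (N := N) hC hK hp hc₀ ht hinv cs hρT b
  refine ⟨ℓ, hbℓ, hℓ, hℓN, hℓD, hℓp, hprime, hfrob, fun x hx v hv ↦ ?_⟩
  have hmG : ∀ y ∈ AddSubgroup.closure (Set.range cs),
      h1Eval (W.baseChange K) ((p ^ M : ℕ) : ℤ) y m = 0 := by
    intro y hy
    induction hy using AddSubgroup.closure_induction with
    | mem z hz => obtain ⟨i, rfl⟩ := hz; exact hm.2 i
    | zero => exact h1Eval_zero _ _ hm.1
    | add a a' _ _ ha ha' => rw [h1Eval_add _ _ _ _ hm.1, ha, ha', add_zero]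
    | neg a _ ha => rw [h1Eval_neg _ _ _ hm.1, ha, neg_zero]
  rw [hloc x hx v hv, h1Eval_conjGalCMH_mul_mul_eq_two_zsmul W ht hinv _ hG hρT hστ hm.1 hmG hx,
    two_zsmul_eq_zero_iff W hu]

/-- **McCallum 1991, Prop. 3.1 (kernel form) from EIGEN-TARGETS — image-free.** Same, with the
intertwining supplied by McCallum's recipe: the generators are `c_*`-eigenclasses
(`c_* x_i = ν_i x_i`, `ν_i = ±1`) and `ρ` gives them `τ`-eigen values OF THE SAME SIGNS
(`τ [x_i, ρ] = ν_i [x_i, ρ]`). Conclusion as in `…_of_intertwining`: `x_λ = 0 ⟺ [x, ρ] = 0` on the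
span. [cite: McCallumLMS1991, §3 Prop. 3.1 with (2), (3)] -/
theorem exists_kolyvaginPrime_gt_pow_kernel_of_eigenTargets (hC : Literature.NumberTheory.Automorphic.chebotarev_artinRep)
    {N : ℕ} [NeZero N] [W.IsElliptic] (hK : IsImaginaryQuadratic K) {p : ℕ} (hp : p.Prime)
    (hp2 : p ≠ 2) {M : ℕ} {c : K ≃ₐ[ℚ] K} {c₀ : absoluteGaloisGroup ℚ}
    (hc₀ : IsComplexConjugation (Rat.castHom ℝ) c₀)
    (ht : IsLiftOfAut c (absGaloisTransport (K := ℚ) (L := K) c₀).toRingEquiv)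
    (hinv : ∀ x, (absGaloisTransport (K := ℚ) (L := K) c₀).toRingEquiv
      ((absGaloisTransport (K := ℚ) (L := K) c₀).toRingEquiv x) = x)
    {ι : Type*} [Fintype ι] (cs : ι → galH1Torsion (W.baseChange K) ((p ^ M : ℕ) : ℤ))
    {ν : ι → ℤ} (hcs : ∀ i, conjAct W c ((p ^ M : ℕ) : ℤ) (cs i) = ν i • cs i)
    {ρ : absoluteGaloisGroup K} (hρT : ρ ∈ torsionFixing (W.baseChange K) ((p ^ M : ℕ) : ℤ))
    (hvals : ∀ i, ht.torsionMap W ((p ^ M : ℕ) : ℤ) (h1Eval (W.baseChange K) ((p ^ M : ℕ) : ℤ) (cs i) ρ) =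
      ν i • h1Eval (W.baseChange K) ((p ^ M : ℕ) : ℤ) (cs i) ρ)
    (b : ℕ) :
    ∃ ℓ : ℕ, b < ℓ ∧ ℓ.Prime ∧ ¬ ℓ ∣ N ∧ ¬ ((ℓ : ℤ) ∣ NumberField.discr K) ∧ ℓ ≠ p ∧
      (Ideal.span {(ℓ : 𝓞 K)}).IsPrime ∧ FrobEqFrobInfty W K (p ^ M) ℓ ∧
      ∀ x ∈ AddSubgroup.closure (Set.range cs),
        ∀ v : HeightOneSpectrum (𝓞 K), (ℓ : 𝓞 K) ∈ v.asIdeal →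
          (x ∈ (W.baseChange K).torsionLocalKer (v.adicCompletion K) ((p ^ M : ℕ) : ℤ) ↔
            h1Eval (W.baseChange K) ((p ^ M : ℕ) : ℤ) x ρ = 0) :=
  exists_kolyvaginPrime_gt_pow_kernel_of_intertwining (N := N) hC hK hp hp2 hc₀ ht hinv cs
    (fun _ hx ↦ conjAct_mem_closure_of_eigen W _ hcs hx) hρT
    (fun _ hx ↦ h1Eval_conjAct_eq_torsionMap_of_eigen W ht _ hcs hρT hvals hx) b

/-- **Packaged with `IsKolyvaginPrime`** (as the tree's `McCallum1991_prop_3_1_kernel_of_chebotarev`):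
the prime of `exists_kolyvaginPrime_gt_pow_kernel_of_intertwining` is a Kolyvagin prime of `(E, K, p)`
at level `N` with `Frob(ℓ) = Frob(∞)` on `K(E_{p^M})`. [cite: McCallumLMS1991, §3 Prop. 3.1 with (2), (3)] -/
theorem exists_isKolyvaginPrime_gt_kernel_of_intertwining (hC : Literature.NumberTheory.Automorphic.chebotarev_artinRep)
    {N : ℕ} [NeZero N] [W.IsElliptic] (hK : IsImaginaryQuadratic K) {p : ℕ} (hp : p.Prime)
    (hp2 : p ≠ 2) {M : ℕ} (hM : 1 ≤ M) {c : K ≃ₐ[ℚ] K} {c₀ : absoluteGaloisGroup ℚ}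
    (hc₀ : IsComplexConjugation (Rat.castHom ℝ) c₀)
    (ht : IsLiftOfAut c (absGaloisTransport (K := ℚ) (L := K) c₀).toRingEquiv)
    (hinv : ∀ x, (absGaloisTransport (K := ℚ) (L := K) c₀).toRingEquiv
      ((absGaloisTransport (K := ℚ) (L := K) c₀).toRingEquiv x) = x)
    {ι : Type*} [Fintype ι] (cs : ι → galH1Torsion (W.baseChange K) ((p ^ M : ℕ) : ℤ))
    (hG : ∀ x ∈ AddSubgroup.closure (Set.range cs),
      conjAct W c ((p ^ M : ℕ) : ℤ) x ∈ AddSubgroup.closure (Set.range cs))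
    {ρ : absoluteGaloisGroup K} (hρT : ρ ∈ torsionFixing (W.baseChange K) ((p ^ M : ℕ) : ℤ))
    (hστ : ∀ x ∈ AddSubgroup.closure (Set.range cs),
      h1Eval (W.baseChange K) ((p ^ M : ℕ) : ℤ) (conjAct W c ((p ^ M : ℕ) : ℤ) x) ρ =
        ht.torsionMap W ((p ^ M : ℕ) : ℤ) (h1Eval (W.baseChange K) ((p ^ M : ℕ) : ℤ) x ρ))
    (b : ℕ) :
    ∃ ℓ : ℕ, b < ℓ ∧ IsKolyvaginPrime N W K p ℓ ∧ FrobEqFrobInfty W K (p ^ M) ℓ ∧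
      ∀ x ∈ AddSubgroup.closure (Set.range cs),
        ∀ v : HeightOneSpectrum (𝓞 K), (ℓ : 𝓞 K) ∈ v.asIdeal →
          (x ∈ (W.baseChange K).torsionLocalKer (v.adicCompletion K) ((p ^ M : ℕ) : ℤ) ↔
            h1Eval (W.baseChange K) ((p ^ M : ℕ) : ℤ) x ρ = 0) := by
  obtain ⟨ℓ, hbℓ, hℓ, hℓN, hℓD, hℓp, hprime, hfrob, hloc⟩ :=
    exists_kolyvaginPrime_gt_pow_kernel_of_intertwining (N := N) hC hK hp hp2 hc₀ ht hinv cs hG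
      hρT hστ b
  exact ⟨ℓ, hbℓ, ⟨hℓ, hℓN, hℓD, hℓp, hprime, hfrob.of_dvd (dvd_pow_self p (by omega))⟩, hfrob, hloc⟩

end Kernel

/-! ## §3 The Borel CM instance: the realiser from the `𝔭`-adic McCallum (2) of the class -/

section Borel

variable (W : WeierstrassCurve ℚ) [W.IsElliptic] (p : ℕ) [Fact p.Prime]
  (K : Type) [Field K] [NumberField K]

/-- **McCallum 1991, Prop. 3.1 in kernel form AT THE BOREL CM-RAMIFIED PRIME.** `W` with CM,
`p ≥ 5` CM-ramified (so `ρ̄_{W,p}` is Borel and the tree's Step A fails: no `−1` in the image,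
`W[p]` not simple), the `𝓞_𝔭`-structure `μ` (`μ² = [m]`, `|m| = p`, commuting with `Γ_{ℚ(√−p)}`;
from `BorelHomothety.exists_sqrt_end_of_cmRamified`), `K` imaginary quadratic (degree `2 < p`)
with complex conjugation `c` lifted along `c₀`; `M ≥ 1`; `c_*`-eigenclasses
`x_i ∈ H¹(K, W[p^M])^{ν_i}` with `𝓞`-DEPTHS `e_i` (`μ^{e_i}` kills every value `[x_i, ·]`) and
INDEPENDENT TOP-LAYER FUNCTIONALS (`∑ c_i μ^{e_i−1}[x_i, ·] ≡ 0 ⟹ p ∣ c_i` when `e_i > 0`); and ANY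
targets `t_i ∈ W[𝔭^{e_i}]` which are `τ`-eigen OF THE SAME SIGNS (`τ t_i = ν_i t_i`). Then there
are `ρ ∈ Γ_{K(W[p^M])}` with `[x_i, ρ] = t_i` and, above every bound `b`, a Kolyvagin prime `ℓ`
of level `p^M` (`ℓ ∤ N d_K p`, inert, `Frob(ℓ) = Frob(∞)` on `K(W_{p^M})`) with
**`x_λ = 0 ⟺ [x, ρ] = 0` for every `x` in the span of the `x_i`** — McCallum's (3) for the
character `∑ a_i x_i ↦ ∑ a_i t_i`. No image hypothesis: the realiser is the class's
`exists_h1Eval_eq_pow_of_cmRamified` (uniserial `W[p^M]`). Which eigen-targets of prescribed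
annihilator EXIST in `W[𝔭^{e}]` is the visibility question (sibling file). [cite: McCallumLMS1991, §3 Prop. 3.1 with (2), (3)] -/
theorem exists_kolyvaginPrime_gt_pow_kernel_of_cmRamified (hC : Literature.NumberTheory.Automorphic.chebotarev_artinRep)
    {N : ℕ} [NeZero N] (hCM : W.HasCM) (h5 : 5 ≤ p) (hram : CMRamified W p)
    {s : AlgebraicClosure ℚ} {μ : AddMonoid.End W.geomPoints} {m : ℤ}
    (hs : s ^ 2 = ((-(p : ℤ) : ℤ) : AlgebraicClosure ℚ)) (hm : m.natAbs = p)
    (hμμ : ∀ P, μ (μ P) = m • P)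
    (hcomm : ∀ g : absoluteGaloisGroup ℚ, g • s = s → ∀ P, μ (g • P) = g • μ P)
    (hK : IsImaginaryQuadratic K) {M : ℕ} (hM : 1 ≤ M) {c : K ≃ₐ[ℚ] K}
    {c₀ : absoluteGaloisGroup ℚ} (hc₀ : IsComplexConjugation (Rat.castHom ℝ) c₀)
    (ht : IsLiftOfAut c (absGaloisTransport (K := ℚ) (L := K) c₀).toRingEquiv)
    (hinv : ∀ x, (absGaloisTransport (K := ℚ) (L := K) c₀).toRingEquiv
      ((absGaloisTransport (K := ℚ) (L := K) c₀).toRingEquiv x) = x)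
    {ι : Type*} [Fintype ι] (xs : ι → galH1Torsion (W.baseChange K) ((p ^ M : ℕ) : ℤ))
    {ν : ι → ℤ} (hxs : ∀ i, conjAct W c ((p ^ M : ℕ) : ℤ) (xs i) = ν i • xs i) (e : ι → ℕ)
    (he : ∀ i, ∀ ρ ∈ torsionFixing (W.baseChange K) ((p ^ M : ℕ) : ℤ),
      (μ ^ e i) ((RatClosure.torsionEquiv (K := K) W ((p ^ M : ℕ) : ℤ)).symm
        (h1Eval (W.baseChange K) ((p ^ M : ℕ) : ℤ) (xs i) ρ) : W.geomPoints) = 0)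
    (hind : ∀ c : ι → ℤ,
      (∀ ρ ∈ torsionFixing (W.baseChange K) ((p ^ M : ℕ) : ℤ),
        ∑ i, c i • (μ ^ (e i - 1)) ((RatClosure.torsionEquiv (K := K) W ((p ^ M : ℕ) : ℤ)).symm
          (h1Eval (W.baseChange K) ((p ^ M : ℕ) : ℤ) (xs i) ρ) : W.geomPoints) = 0) →
        ∀ i, 0 < e i → (p : ℤ) ∣ c i)
    (t : ι → geomTorsion (W.baseChange K) ((p ^ M : ℕ) : ℤ))
    (hte : ∀ i, (μ ^ e i)
      ((RatClosure.torsionEquiv (K := K) W ((p ^ M : ℕ) : ℤ)).symm (t i) : W.geomPoints) = 0)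
    (htν : ∀ i, ht.torsionMap W ((p ^ M : ℕ) : ℤ) (t i) = ν i • t i) (b : ℕ) :
    ∃ ρ ∈ torsionFixing (W.baseChange K) ((p ^ M : ℕ) : ℤ),
      (∀ i, h1Eval (W.baseChange K) ((p ^ M : ℕ) : ℤ) (xs i) ρ = t i) ∧
      ∃ ℓ : ℕ, b < ℓ ∧ ℓ.Prime ∧ ¬ ℓ ∣ N ∧ ¬ ((ℓ : ℤ) ∣ NumberField.discr K) ∧ ℓ ≠ p ∧
        (Ideal.span {(ℓ : 𝓞 K)}).IsPrime ∧ FrobEqFrobInfty W K (p ^ M) ℓ ∧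
        ∀ x ∈ AddSubgroup.closure (Set.range xs),
          ∀ v : HeightOneSpectrum (𝓞 K), (ℓ : 𝓞 K) ∈ v.asIdeal →
            (x ∈ (W.baseChange K).torsionLocalKer (v.adicCompletion K) ((p ^ M : ℕ) : ℤ) ↔
              h1Eval (W.baseChange K) ((p ^ M : ℕ) : ℤ) x ρ = 0) := by
  have hp : p.Prime := Fact.out
  have hp2 : p ≠ 2 := by omega
  have hKp : Module.finrank ℚ K < p := by rw [hK.1]; omega
  obtain ⟨ρ, hρT, hρt⟩ := exists_h1Eval_eq_pow_of_cmRamified W p K hCM h5 hram hs hm hμμ hcomm hKp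
    hM xs e he hind t hte
  refine ⟨ρ, hρT, hρt, ?_⟩
  exact exists_kolyvaginPrime_gt_pow_kernel_of_eigenTargets (N := N) hC hK hp hp2 hc₀ ht hinv xs
    hxs hρT (fun i ↦ by rw [hρt i, htν i]) b

end Borel

end Summit.BirchSwinnertonDyer.BirchSwinnertonDyer.Theorems.PrintCFram.BorelKolyvaginPairing

end
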